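import Mathlib
import Summits.MatrixMultiplication.MatrixMultiplication.Theses.PauliSmithLocalisation
import Summits.MatrixMultiplication.MatrixMultiplication.Theorems.PauliSmithLocalisationTargetsGiveGap
import Summits.MatrixMultiplication.MatrixMultiplication.Theorems.PauliSmithLocalisationFixedPointFreeTargetsStubTarget
import Summits.MatrixMultiplication.MatrixMultiplication.Theorems.PauliSmithLocalisationFixedPointFreeTargetsStubActZero
import Summits.MatrixMultiplication.MatrixMultiplication.Theorems.PauliSmithLocalisationFixedPointFreeTargetsStubActAdd
import Summits.MatrixMultiplication.MatrixMultiplication.Theorems.PauliSmithLocalisationFixedPointFreeTargetsStubActContinuous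
import Summits.MatrixMultiplication.MatrixMultiplication.Theorems.PauliSmithLocalisationFixedPointFreeTargetsStubFixedSpace
import Summits.MatrixMultiplication.MatrixMultiplication.Theorems.PauliSmithLocalisationFixedPointFreeTargetsStubBorderRankSmul
import Summits.MatrixMultiplication.MatrixMultiplication.Theorems.PauliSmithLocalisationFixedPointFreeTargetsStubBorderRankMatMul

/-!
# Crux `FixedPointFreeTargets` (stmt-MatrixMultiplication-15042), line `Sketch`:
the tautological target `SmithPhaseGap → FixedPointFreeTargets`

Route PauliSmithLocalisation files the border-rank gap `bR(⟨p^k,p^k,p^k⟩) > p^((2+δ)k)` in two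
forms: in coordinates (`SmithPhaseGap`, item stmt-MatrixMultiplication-9876) and in Smith form
(`FixedPointFreeTargets`: for every `r ≤ (p^k)^(2+δ)` the border-rank locus `S_r ∖ {0}` carries a
continuous, equivariant, nowhere-zero map to a representation of the Heisenberg `p`-torus
`E = (F_p^(2k))³` without non-zero fixed vectors).  `TargetsGiveGap` (Smith form ⇒ coordinates) is
proved in tree; this file proves the converse, so the two items are formally EQUIVALENT:

* `stub_target` — the universal difference target of any continuous action of a finite abelian
  group: `f x = (x_t ∘ act g - x_t)_{g ≠ 0, t}`, `ρ_h F(g) = F(g+h) - F(h)`; fixed vectors of `ρ`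
  are additive maps out of a torsion group, hence `0`; `f x = 0` iff `x` is `E`-fixed;
* `stub_actZero`, `stub_actAdd`, `stub_actContinuous` — the pinned Pauli sandwich IS a continuous
  action (Weyl rule, phases cancel in conjugate slot pairs);
* `stub_fixedSpace` — `V^E = ℂ · M`, `M = ⟨n,n,n⟩` on `I × I` (the commutant of the Weyl–Heisenberg
  matrices is scalar, in the three slot pairs);
* `stub_borderRank_smul`, `stub_borderRank_matMul` — `bR (c • M) = bR M = bR ⟨p^k,p^k,p^k⟩`.

Hence a zero of `f` on `S_r ∖ {0}` with `r ≤ (p^k)^(2+δ) < bR ⟨p^k,p^k,p^k⟩` (the gap) would be a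
non-zero multiple of `M` of border rank `≤ r`: impossible.  Consequently the crux is exactly as
hard as `SmithPhaseGap` (`ω(ℂ) > 2` along prime powers); continuity adds nothing.

References: T. tom Dieck, *Transformation Groups*, de Gruyter (1987), ch. I; M. Bläser, *Fast
Matrix Multiplication*, Theory of Computing Graduate Surveys 5 (2013), §6 (border rank).
-/

set_option linter.dupNamespace false

noncomputable section

namespace Summit.MatrixMultiplication.MatrixMultiplication.Theorems

open scoped BigOperators ComplexConjugate
open Literature.Computability.AlgebraicComplexity

namespace PauliTautologicalTarget

section Levelwise

variable {p k : ℕ}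
  {P : (Fin k → ZMod p) → (Fin k → ZMod p) → Matrix (Fin k → ZMod p) (Fin k → ZMod p) ℂ}
  {act : ((Fin k → ZMod p) × (Fin k → ZMod p)) × ((Fin k → ZMod p) × (Fin k → ZMod p)) ×
      ((Fin k → ZMod p) × (Fin k → ZMod p)) →
    (((Fin k → ZMod p) × (Fin k → ZMod p)) → ((Fin k → ZMod p) × (Fin k → ZMod p)) →
      ((Fin k → ZMod p) × (Fin k → ZMod p)) → ℂ) →
    (((Fin k → ZMod p) × (Fin k → ZMod p)) → ((Fin k → ZMod p) × (Fin k → ZMod p)) →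
      ((Fin k → ZMod p) × (Fin k → ZMod p)) → ℂ)}

/-- **Targets exist at every level below the border rank** (levelwise converse dictionary): for
the pinned Pauli sandwich action at ANY `(p, k)` and every `r < bR ⟨p^k,p^k,p^k⟩` there is a
fixed-point-free `E`-target on `S_r ∖ {0}` — the universal difference target, whose zeros are the
fixed tensors `c • M`, all of border rank `bR ⟨p^k,p^k,p^k⟩ > r`.  In particular every printed lower
bound for `bR ⟨n,n,n⟩` (e.g. `2n² - ⌈log₂ n⌉ - 1`) yields targets up to that level with no further
work. [cite: tomDieck1987, ch. I] [cite: Blaser2013, §6] -/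
theorem targets_of_lt_algBorderRank [Fact p.Prime]
    (hP : ∀ x z u v, P x z u v = if u = v + x then
      Complex.exp (2 * Real.pi * Complex.I * ((∑ i, z i * v i).val : ℂ) / (p : ℂ)) else 0)
    (hact : ∀ g x a b c, act g x a b c = ∑ a', ∑ b', ∑ c',
      (starRingEnd ℂ (P g.1.1 g.1.2 a.1 a'.1) * P g.2.2.1 g.2.2.2 a.2 a'.2) *
      (P g.1.1 g.1.2 b.1 b'.1 * starRingEnd ℂ (P g.2.1.1 g.2.1.2 b.2 b'.2)) *
      (P g.2.1.1 g.2.1.2 c.1 c'.1 * starRingEnd ℂ (P g.2.2.1 g.2.2.2 c.2 c'.2)) * x a' b' c')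
    {r : ℕ} (hr : r < algBorderRank (matMulTensor ℂ (p ^ k) (p ^ k) (p ^ k))) :
    ∃ (d : ℕ) (ρ : ((Fin k → ZMod p) × (Fin k → ZMod p)) × ((Fin k → ZMod p) × (Fin k → ZMod p)) ×
        ((Fin k → ZMod p) × (Fin k → ZMod p)) → Matrix (Fin d) (Fin d) ℂ)
      (f : (((Fin k → ZMod p) × (Fin k → ZMod p)) → ((Fin k → ZMod p) × (Fin k → ZMod p)) →
        ((Fin k → ZMod p) × (Fin k → ZMod p)) → ℂ) → (Fin d → ℂ)),
      ρ 0 = 1 ∧ (∀ g h, ρ (g + h) = ρ g * ρ h) ∧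
      (∀ w : Fin d → ℂ, (∀ g, (ρ g).mulVec w = w) → w = 0) ∧
      ContinuousOn f {x | x ≠ 0 ∧ algBorderRank x ≤ r} ∧
      (∀ x, x ≠ 0 → algBorderRank x ≤ r → f x ≠ 0) ∧
      (∀ g x, algBorderRank x ≤ r → f (act g x) = (ρ g).mulVec (f x)) := by
  -- the universal target of the pinned action
  obtain ⟨d, ρ, f, h1, h2, h3, h4, h5, h6⟩ :=
    stub_target
      (E := ((Fin k → ZMod p) × (Fin k → ZMod p)) × ((Fin k → ZMod p) × (Fin k → ZMod p)) ×
        ((Fin k → ZMod p) × (Fin k → ZMod p)))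
      (T := ((Fin k → ZMod p) × (Fin k → ZMod p)) × ((Fin k → ZMod p) × (Fin k → ZMod p)) ×
        ((Fin k → ZMod p) × (Fin k → ZMod p)))
      (V := ((Fin k → ZMod p) × (Fin k → ZMod p)) → ((Fin k → ZMod p) × (Fin k → ZMod p)) →
        ((Fin k → ZMod p) × (Fin k → ZMod p)) → ℂ)
      (fun t x => x t.1 t.2.1 t.2.2)
      (fun t => ((continuous_apply t.2.2).comp
        ((continuous_apply t.2.1).comp (continuous_apply t.1))))
      (fun x y hxy => funext fun a => funext fun b => funext fun c => hxy (a, b, c))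
      act (stub_actZero hP hact) (stub_actAdd hP hact) (stub_actContinuous hact)
  refine ⟨d, ρ, f, h1, h2, h3, h4.continuousOn, fun x hx0 hxr hfx => ?_, fun g x _ => h6 g x⟩
  -- a zero of `f` on `S_r ∖ {0}` is a fixed tensor, i.e. a non-zero multiple of `M`
  have hxM := stub_fixedSpace hP hact x (h5 x hfx)
  have hc : x 0 0 0 ≠ 0 := by
    intro hc
    apply hx0
    rw [hxM, hc, zero_smul]
  have hbr : algBorderRank x = algBorderRank (matMulTensor ℂ (p ^ k) (p ^ k) (p ^ k)) := by
    rw [hxM]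
    exact (stub_borderRank_smul _ hc _).trans (stub_borderRank_matMul p k)
  -- … of border rank `≤ r < bR ⟨p^k,p^k,p^k⟩ = bR x`: contradiction
  rw [← hbr] at hr
  exact absurd hxr (not_le.2 hr)

end Levelwise

/-- **The tautological target** (crux `FixedPointFreeTargets`, line `Sketch`; the shared stub of
the crux cards `support-exponent-descent` and `one-step-kronecker-gap`):
`SmithPhaseGap → FixedPointFreeTargets`.  With the universal difference target of the pinned Pauli
sandwich action (zero set = fixed tensors = `ℂ · M`), a zero on `S_r ∖ {0}`,
`r ≤ (p^k)^(2+δ) < bR ⟨p^k,p^k,p^k⟩ = bR M`, is impossible. [cite: tomDieck1987, ch. I]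
[cite: Blaser2013, §6] -/
theorem FixedPointFreeTargets_of
    (hGap : Theses.PauliSmithLocalisation.SmithPhaseGap) :
    Theses.PauliSmithLocalisation.FixedPointFreeTargets := by
  unfold Theses.PauliSmithLocalisation.FixedPointFreeTargets
  obtain ⟨p, hp, δ, hδ, k₀, hk⟩ := hGap
  haveI hpF : Fact p.Prime := ⟨hp⟩
  refine ⟨p, hpF, δ, hδ, k₀, fun k hk₀ P hP act hact r hr => targets_of_lt_algBorderRank hP hact ?_⟩
  -- `r ≤ (p^k)^(2+δ) < bR ⟨p^k,p^k,p^k⟩`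
  exact_mod_cast hr.trans_lt (hk k hk₀)

end PauliTautologicalTarget

/-- **`FixedPointFreeTargets ↔ SmithPhaseGap`**: the Smith form of the thesis of route
PauliSmithLocalisation is equivalent to its coordinate form (⇒ is the in-tree `TargetsGiveGap`,
re-derived here from the route's deciding theorem ingredients; ⇐ is the tautological target).
[cite: Blaser2013, §6] -/
theorem fixedPointFreeTargets_iff_smithPhaseGap :
    Theses.PauliSmithLocalisation.FixedPointFreeTargets ↔
      Theses.PauliSmithLocalisation.SmithPhaseGap :=
  ⟨fun h => targetsGiveGap_proof h, PauliTautologicalTarget.FixedPointFreeTargets_of⟩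

end Summit.MatrixMultiplication.MatrixMultiplication.Theorems

end
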